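import Summits.BirchSwinnertonDyer.BirchSwinnertonDyer.Theorems.ManinLocalTwoThreeManinPrimeToThreeAtNineOfOrdJLeZero
import Summits.BirchSwinnertonDyer.BirchSwinnertonDyer.Theorems.ManinLocalTwoThreeIstarJValuation
import Literature.NumberTheory.EllipticCurves.NeronLocalHeightCompletion
import HarnessLib

/-!
# C3 `ManinPrimeToThreeAtNine`: the core BY LEVEL (`9 ∥ N`: rows `III/3`, `III*/9`; `27 ∣ N`: rows `II`, `IV`, `IV*`, `II*`) and in the
# cell's `padicValRat 3 j` currency (route `ManinLocalTwoThree`, crux C3 stmt-BirchSwinnertonDyer-22968; cell bsd-f2-manin, p2 gen 15)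

Sequel to `…ManinPrimeToThreeAtNineOfOrdJLeZero` (C3 on `ord₃ j ≤ 0` and `maninPrimeToThreeAtNine_of_core`).  Two repackagings for the
cell's consumers (LEAD skeleton `kato_shift_three`, an's laws S-an-42/43, E-an-116, which speak `padicValRat 3 W.j`, `padicValInt 3 Δ_min`
and the place `placeOf 3`):
* §1 `padicValRat` currency: `1 ≤ |j|₃ ⟺ ord₃ j ≤ 0` (`j ≠ 0`) and `|j|₃ < 1 ⟺ j = 0 ∨ ord₃ j > 0` at `placeOf 3`
  (`Rat.HeightOneSpectrum.valuation_eq_exp_neg_padicValRat`); `not_three_dvd_maninConstant_of_padicValRat_j_nonpos_of_mazur`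
  (C3 body for `j ≠ 0`, `ord₃ j ≤ 0`, modulo Mazur + modularity); `maninPrimeToThreeAtNine_of_padicValRat_j_pos` (C3 ⟸ C3 on `j = 0 ∨ ord₃ j > 0`).
* §2 BY LEVEL, through the tree's classifications `nine_dvd_conductorNorm_classification` (`9 ∥ N` ⟹ `III/3`, `I₀*/6`, `III*/9`, `Iₙ*/(n+6)`)
  and `kodairaSymbolAt_of_twentyseven_dvd` (`27 ∣ N` ⟹ `II`, `IV`, `IV*`, `II*`): **C3 ⟸ (C3 on the `9 ∥ N` core: type `III` with
  `ord₃ Δ_min = 3` or `III*` with `ord₃ Δ_min = 9`, `ord₃ j > 0` or `j = 0`, `W ⊗ ℚ(√−3)` additive at `3`) ∧ (C3 on the `27 ∣ N` core: type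
  `II`, `IV`, `IV*` or `II*`, same two binders)** — `maninPrimeToThreeAtNine_of_coreByLevel`.  The `Iₙ*` rows (all `n ≥ 0`) and the
  stratum `ord₃ j ≤ 0` are discharged (Stevens on `Γ₀` + Mazur; the OrdJLeZero file).
HONEST FRAMING: reductions by name, modulo the crux's own printed-fact binders; nothing about BSD is proved; Manin's conjecture at `3` stays
OPEN on both level strata of the core; C3 OPEN.
[cite: Stevens1989, Lemmas (5.2), (5.4)] [cite: Mazur1978, Cor. 4.1] [cite: SilvermanATAEC1994, IV.9.4 Table 4.1 and IV.11.1]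
[cite: EdixhovenManin1991, §1]
-/

set_option autoImplicit false
-- lint-debt: the directory name repeats the summit name (sibling precedent `ManinLocalTwoThreeManinPrimeToThreeAtNineOfOrdJLeZero.lean`)
set_option linter.dupNamespace false

noncomputable section

open scoped Classical
open WeierstrassCurve IsDedekindDomain IsDedekindDomain.HeightOneSpectrum Rat.HeightOneSpectrum
  Literature.NumberTheory.DiophantineGeometry Literature.NumberTheory.EllipticCurves
  Literature.NumberTheory.EllipticCurves.ModularForms

namespace Summit.BirchSwinnertonDyer.BirchSwinnertonDyer.Theorems.ManinLocalTwoThree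

open NumberField Summit.BirchSwinnertonDyer.Rank1Residual.Additive

/-! ## §1 The `padicValRat 3 j` currency -/

/-- **`|j|₃ ≥ 1 ⟺ ord₃ j ≤ 0`** for `j ≠ 0` (`|x|_v = exp(−ord₃ x)` at `placeOf 3`). [folklore] -/
theorem one_le_valuation_placeOf_three_iff_padicValRat_nonpos {x : ℚ} (hx : x ≠ 0) :
    1 ≤ (placeOf 3).valuation ℚ x ↔ padicValRat 3 x ≤ 0 := by
  have hgen : natGenerator (placeOf 3) = 3 := congrArg Subtype.val ((primesEquiv (R := ℤ)).apply_symm_apply ⟨3, Nat.prime_three⟩)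
  rw [Rat.HeightOneSpectrum.valuation_eq_exp_neg_padicValRat (placeOf 3) hx, hgen, ← WithZero.exp_zero, WithZero.exp_le_exp]
  omega

/-- **`|j|₃ < 1 ⟺ j = 0 ∨ ord₃ j > 0`** (`|0|_v = 0`). [folklore] -/
theorem valuation_placeOf_three_lt_one_iff (x : ℚ) :
    (placeOf 3).valuation ℚ x < 1 ↔ x = 0 ∨ 0 < padicValRat 3 x := by
  by_cases hx : x = 0
  · simp [hx]
  · have hgen : natGenerator (placeOf 3) = 3 := congrArg Subtype.val ((primesEquiv (R := ℤ)).apply_symm_apply ⟨3, Nat.prime_three⟩)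
    rw [Rat.HeightOneSpectrum.valuation_eq_exp_neg_padicValRat (placeOf 3) hx, hgen, ← WithZero.exp_zero, WithZero.exp_lt_exp]
    constructor
    · intro h; exact Or.inr (by omega)
    · rintro (h | h)
      · exact absurd h hx
      · omega

/-- **C3 on `ord₃ j ≤ 0` in `padicValRat` currency** (Mazur + modularity only): for a lattice-optimal `X₀(N)`-datum of a globally minimal `W`
with `9 ∣ N`, `j(W) ≠ 0` and `padicValRat 3 j(W) ≤ 0`, `3 ∤ c`.  [cite: Stevens1989, Lemmas (5.2), (5.4)] [cite: Mazur1978, Cor. 4.1] -/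
theorem not_three_dvd_maninConstant_of_padicValRat_j_nonpos_of_mazur
    (hM : mazur_not_dvd_maninConstant_of_odd) (hnf : exists_isNewformOf)
    {W : WeierstrassCurve ℚ} [W.IsElliptic] [W.IsGloballyMinimal] {N : ℕ} [NeZero N] (D : ModularParametrizationData W N)
    (hopt : ∀ z ∈ D.L.lattice, ∃ w ∈ periodLattice D.f, z = D.c * w) (h9 : 3 ^ 2 ∣ N)
    (hj0 : W.j ≠ 0) (hj : padicValRat 3 W.j ≤ 0) : ¬ (3 : ℤ) ∣ D.maninConstant :=
  not_three_dvd_maninConstant_of_one_le_valuation_j_of_mazur hM hnf D hopt h9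
    ((one_le_valuation_placeOf_three_iff_padicValRat_nonpos hj0).mpr hj)

/-- **C3 reduced by name to `j = 0 ∨ ord₃ j > 0`** (potentially supersingular at `3`), `padicValRat` currency.
[cite: Stevens1989, Lemmas (5.2), (5.4)] [cite: Mazur1978, Cor. 4.1] -/
theorem maninPrimeToThreeAtNine_of_padicValRat_j_pos
    (hcore : mazur_not_dvd_maninConstant_of_odd → abbesUllmo_not_dvd_maninConstant_of_not_dvd_level →
      cesnavicius_not_two_dvd_maninConstant_of_two_dvd_level → exists_isNewformOf →
      ∀ (W : WeierstrassCurve ℚ) [W.IsElliptic] [W.IsGloballyMinimal] {N : ℕ} [NeZero N] (D : ModularParametrizationData W N),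
        (∀ z ∈ D.L.lattice, ∃ w ∈ periodLattice D.f, z = D.c * w) → 3 ^ 2 ∣ N →
        (W.j = 0 ∨ 0 < padicValRat 3 W.j) → ¬ (3 : ℤ) ∣ D.maninConstant) :
    Summit.BirchSwinnertonDyer.BirchSwinnertonDyer.Theses.ManinLocalTwoThree.ManinPrimeToThreeAtNine :=
  maninPrimeToThreeAtNine_of_pos_ordJ fun hM hAU hC2 hnf W _ _ _ _ D hopt h9 hj ↦
    hcore hM hAU hC2 hnf W D hopt h9 ((valuation_placeOf_three_lt_one_iff W.j).mp hj)

/-! ## §2 The core by level -/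

/-- **C3 from its core, BY LEVEL.**  Granted the four printed facts, suppose `3 ∤ c` for every lattice-optimal `X₀(N)`-datum of every globally
minimal `W` in either of the two strata
* `9 ∥ N`: Kodaira type `III` with `ord₃ Δ_min = 3` or `III*` with `ord₃ Δ_min = 9`, `j = 0 ∨ ord₃ j > 0`, `W ⊗ ℚ(√−3)` additive at `3`;
* `27 ∣ N`: Kodaira type `II`, `IV`, `IV*` or `II*`, `j = 0 ∨ ord₃ j > 0`, `W ⊗ ℚ(√−3)` additive at `3`.
Then `ManinPrimeToThreeAtNine` holds.  The complement: `ord₃ j ≤ 0` (the OrdJLeZero file), a semistable ternary twist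
(`not_dvd_maninConstant_of_isSemistableAt_quadraticTwist_pStar_of_mazur`), the rows `Iₙ*` (`not_dvd_maninConstant_of_kodairaSymbolAt_eq_Istar_of_mazur`);
the level split is the tree's `nine_dvd_conductorNorm_classification` / `kodairaSymbolAt_of_twentyseven_dvd`.
[cite: Stevens1989, Lemmas (5.2), (5.4)] [cite: Mazur1978, Cor. 4.1] [cite: SilvermanATAEC1994, IV.9.4 Table 4.1 and IV.11.1] -/
theorem maninPrimeToThreeAtNine_of_coreByLevel
    (h9 : mazur_not_dvd_maninConstant_of_odd → abbesUllmo_not_dvd_maninConstant_of_not_dvd_level →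
      cesnavicius_not_two_dvd_maninConstant_of_two_dvd_level → exists_isNewformOf →
      ∀ (W : WeierstrassCurve ℚ) [W.IsElliptic] [W.IsGloballyMinimal] {N : ℕ} [NeZero N] (D : ModularParametrizationData W N),
        (∀ z ∈ D.L.lattice, ∃ w ∈ periodLattice D.f, z = D.c * w) → 3 ^ 2 ∣ N → ¬ 3 ^ 3 ∣ N →
        ((W.kodairaSymbolAt (placeOf 3) = .III ∧ padicValInt 3 W.minimalDiscriminantInt = 3) ∨
          (W.kodairaSymbolAt (placeOf 3) = .IIIstar ∧ padicValInt 3 W.minimalDiscriminantInt = 9)) →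
        (W.j = 0 ∨ 0 < padicValRat 3 W.j) →
        (haveI := W.isElliptic_quadraticTwist (show ((-3 : ℤ) : ℚ) ≠ 0 by norm_num);
          (W.quadraticTwist ((-3 : ℤ) : ℚ)).HasAdditiveReductionAt (placeOf 3)) →
        ¬ (3 : ℤ) ∣ D.maninConstant)
    (h27 : mazur_not_dvd_maninConstant_of_odd → abbesUllmo_not_dvd_maninConstant_of_not_dvd_level →
      cesnavicius_not_two_dvd_maninConstant_of_two_dvd_level → exists_isNewformOf →
      ∀ (W : WeierstrassCurve ℚ) [W.IsElliptic] [W.IsGloballyMinimal] {N : ℕ} [NeZero N] (D : ModularParametrizationData W N),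
        (∀ z ∈ D.L.lattice, ∃ w ∈ periodLattice D.f, z = D.c * w) → 3 ^ 3 ∣ N →
        (W.kodairaSymbolAt (placeOf 3) = .II ∨ W.kodairaSymbolAt (placeOf 3) = .IV ∨
          W.kodairaSymbolAt (placeOf 3) = .IVstar ∨ W.kodairaSymbolAt (placeOf 3) = .IIstar) →
        (W.j = 0 ∨ 0 < padicValRat 3 W.j) →
        (haveI := W.isElliptic_quadraticTwist (show ((-3 : ℤ) : ℚ) ≠ 0 by norm_num);
          (W.quadraticTwist ((-3 : ℤ) : ℚ)).HasAdditiveReductionAt (placeOf 3)) →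
        ¬ (3 : ℤ) ∣ D.maninConstant) :
    Summit.BirchSwinnertonDyer.BirchSwinnertonDyer.Theses.ManinLocalTwoThree.ManinPrimeToThreeAtNine := by
  refine maninPrimeToThreeAtNine_of_core fun hM hAU hC2 hnf W _ _ N _ D hopt h9N hj _ htw ↦ ?_
  have hj' : W.j = 0 ∨ 0 < padicValRat 3 W.j := (valuation_placeOf_three_lt_one_iff W.j).mp hj
  have hN : N = W.conductorNorm ℤ := IsNewformOf.level_eq_conductorNorm_of_exists_isNewformOf hnf D.isNewformOf
  by_cases h27N : 3 ^ 3 ∣ N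
  · exact h27 hM hAU hC2 hnf W D hopt h27N (kodairaSymbolAt_of_twentyseven_dvd W (hN ▸ h27N)) hj' htw
  · rcases nine_dvd_conductorNorm_classification W (hN ▸ h9N) (hN ▸ h27N) with
      ⟨hK, hΔ⟩ | ⟨hK, -⟩ | ⟨hK, hΔ⟩ | ⟨n, hK, -, -⟩
    · exact h9 hM hAU hC2 hnf W D hopt h9N h27N (Or.inl ⟨hK, hΔ⟩) hj' htw
    · exact not_dvd_maninConstant_of_kodairaSymbolAt_eq_Istar_of_mazur hM hnf D hopt Nat.prime_three (by decide) hK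
    · exact h9 hM hAU hC2 hnf W D hopt h9N h27N (Or.inr ⟨hK, hΔ⟩) hj' htw
    · exact not_dvd_maninConstant_of_kodairaSymbolAt_eq_Istar_of_mazur hM hnf D hopt Nat.prime_three (by decide) hK

end Summit.BirchSwinnertonDyer.BirchSwinnertonDyer.Theorems.ManinLocalTwoThree

end
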